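import Summits.Langlands.Langlands.Theses.ParityBlindBianchi
import Summits.Langlands.Langlands.Theorems.ParityBlindBianchiTwoAdicBianchiProModularityLevelBridge
import Summits.Langlands.Langlands.Theorems.ParityBlindBianchiTwoAdicBianchiProModularityLevelZeroMem
import Literature.NumberTheory.GaloisRepresentations.PolarizedDeformationRing
import Literature.NumberTheory.Automorphic.RegularAlgebraicCuspidalHeckePointProofs
import Summits.Langlands.Langlands.Theorems.ParityBlindBianchiTwoAdicBianchiProModularityLevelSqueezeDefs
import Summits.Langlands.Langlands.Theorems.ParityBlindBianchiTwoAdicBianchiProModularityLevelSqueezeDefsLoci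
import Summits.Langlands.Langlands.Theorems.ParityBlindBianchiTwoAdicBianchiProModularityLevelSqueezeStubSetup
import Literature.NumberTheory.GaloisRepresentations.IntegralGaloisAction
import HarnessLib

/-!
# Line `DimensionSqueeze` for the crux `TwoAdicBianchiProModularityLevel` (stmt-Langlands-15110)

Crux-strategist line (wall-breaker, 2026-08-17).  Idea card: `Lines/dimension-squeeze.md`.
Skeleton v2→v7 (lead prover-line-stmt-Langlands-15110-c14, 2026-08-17; v5 = v3 vocabulary `typeIdealD`/`locusOf`/`heckeIdealOf`
after the GAL-v2 refutation, `stub_setup` LANDED and imported; v7 = the v3 vocabulary imported from the landed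
`…SqueezeDefsLoci.lean` (p139601) instead of the inline copy, stubs unchanged; landed v3 pieces: `…SqueezeArtinTypePointD`
(p140270), `…SqueezeAutGeneric` (p140274), `…SqueezeDefsHecke` (p140338), `…SqueezeLocusOfStructure` (p141728),
`…SqueezeUnframing` (p142302), `…SqueezeReadGeneric` / `…SqueezeOfCore` (re-proposed); census in `Lines/dimension-squeeze-c14.md`): (i) `Model` carries a frame
change (`σ_𝒪 ↦ P⁻¹ σ P`: the crux's `σ` need not have `2`-adically integral entries, so v1's
`stub_setup` was unsatisfiable as typed); (ii) the type ideal also pins the inertial TRACES at the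
odd bad places, and GAL / READ are stated for the type LOCUS ideal `⨅_{φ type-θ} ker φ` (Kisin's
reduced `2`-torsion-free typed quotient) — v1's `stub_galoisDomain` was false (twist by a quadratic
character ramified at one odd bad place: two `𝒪`-points of different inertial trace type on which a
finite-order `ρ^univ(τ)` would have to be constant in a domain); (iii) AUT is stated for `R ⧸ J_U`
(Hecke points are type points, `I^θ ≤ J_U`).  Composition unchanged: `B ⇐ setup ∧ GAL ∧ AUT ∧ READ`.

THE MOVE (Gouvêa–Mazur–Böckle transplanted to defect `l₀ = 1`, with the infinite fern REPLACED by
torsion dimension).  Let `σ̄` be the reduction of the icosahedral `σ : Γ_K → GL₂(𝒪) ⊂ GL₂(ℚ̄₂)`,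
`S` the places of `K` over `S₀`, and `R` Mazur's universal deformation ring of `σ̄` unramified
outside `S` (the tree's `PolarizedDeformationRing` of the datum with NO polarisation, `Θ = ∅`).
Let `R^♭ := R ⧸ I_θ` be its quotient by the TYPE IDEAL of `σ`: determinant equal to `det σ` and
"`σ`-minimal" at the odd places of `S` (`ρ` kills `I_w ∩ ker σ`), no condition at `v ∣ 2`.  For a
tame level `U` let `J_U ⊆ R` be the ideal of functions vanishing at every characteristic-`0`
HECKE POINT of type `θ` at level `U` (the `𝒪_{ℚ̄₂}`-points `φ` of `R` whose Galois representation
`φ ∘ ρ^univ` has Hansen data forming a point of `Spf 𝕋(U²)` of the `2`-power Bianchi tower).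

* `stub_galoisDomain` (GAL, Galois side, OPEN in general, THEOREM-SIZED when the strict dual
  Selmer group `H¹_{L⊥}(K, pgl₂(σ̄))` vanishes): `R^♭` is an integral domain of Krull dimension
  `≤ 4` (`4 = 1 + dim B(PGL₂, two places over 2) − l₀`; Kisin's presentation over the local rings,
  Böckle–Iyengar–Paškūnas Thm 1.4: the fixed-determinant framed rings at `v ∣ 2` are normal
  domains for ALL `p`, in particular `p = 2`).
* `stub_heckeDimension` (AUT, automorphic side, OPEN): if the residual eigensystem of `σ` occurs at
  some tame level, then at some tame level `U` (small over `S₀`) the Zariski closure of the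
  type-`θ` Hecke points in `Spec R^♭` has Krull dimension `≥ 4` — i.e. `dim 𝕋(U²)^θ_𝔪 ≥ 4` and
  `ϖ`-torsion-free: Gee–Newton Prop. 54 (unconditional for `GL₂` over imaginary quadratic `K`) +
  their hypotheses (c)-lite/(c) (Rem. 55(3), Rem. 58: codimension of the `𝔪`-fibre ≥ `dim B`, a
  statement about the GK-dimension of a smooth `GL₂(ℚ₂)²`-representation) + freeness of the
  diamond `2`-group action (Carayol-type) + the comparison lemmas of their App. §6.3 — the
  "Emerton ICM heuristic" as an INEQUALITY; no patching, no Taylor–Wiles primes, no `p`-adic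
  local–global compatibility at `2`.
* `stub_zariskiReadout` (READ, theorem-in-print-sized): if `J_U ≤ I_θ` (type-`θ` Hecke points are
  Zariski-dense in `Spec R^♭`) then the Hansen data of `σ` IS a point of `Spf 𝕋(U²)` — every
  relation of the big Hecke algebra is then a relation of `R^♭`, which `σ` satisfies (Scholze's
  `𝕋_𝔪`-valued determinant, Mazur universality, automatic continuity); the converse mechanism of
  `Disproof.IsHeckePoint.lift_mem_span_pow`.
* `stub_setup` (theorem-sized): an integral model of `σ` over a finite extension of `ℚ₂` and the
  universal ring exist (finite image; Schur for the absolutely irreducible `σ̄`; the tree's proved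
  `polarizedDeformationRing_nonempty_holds`).
* `stub_classicalHeckePoint` (A-raw, shared verbatim with line `Sketch`): Eichler–Shimura–Harder +
  Scholze §V.4, the case `p = 2` of the Literature fact `bianchi_regularAlgebraicCuspidal_isHeckePoint`.

The pure algebra of the squeeze (`dimensionDrop`: in a domain of finite Krull dimension a quotient
of the same dimension is by the zero ideal) is PROVED below, and so is the composition:
`artinLift_of_squeeze : stubs → (B)` (the registered `stub_artinLift` of line `Sketch`, i.e.
`ArtinLiftIsHeckePointTwo`), and `TwoAdicBianchiProModularityLevel_of : crux` through the landed
bridge `crux ⇐ A ∧ B` (p108612).  Coverage: ALL `σ` of the crux (`θ = θ(σ)` is read off `σ`; no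
base-change, ordinarity or local-type restriction).
-/

noncomputable section

set_option linter.dupNamespace false -- `Summit.Langlands.Langlands` is the mandated namespace (D-0017)

open scoped NumberField MatrixGroups
open Polynomial IsDedekindDomain Field
open Literature.NumberTheory.GaloisRepresentations Literature.NumberTheory.Automorphic

namespace Summit.Langlands.Langlands.Cruxes.TwoAdicBianchiProModularityLevel.DimensionSqueeze

/-! ### Vocabulary

v3–v7: the vocabulary (`O2`, `Good`, `badSet`, `IsTameLevel`, `IsPointAt`, `IsAssocBare`, `Model`,
`typeIdeal`, `typePoints`, `typeLocusIdeal`, `heckePoints`, `heckeIdeal`, plumbing lemmas) is the LANDED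
Defs file `Theorems/ParityBlindBianchiTwoAdicBianchiProModularityLevelSqueezeDefs.lean` (p137908), and the v3 loci
(`Model.pointsOf`, `Model.locusOf`, `Model.heckePointsOf`, `Model.heckeIdealOf`, `Model.InertiaNonabelianAt`,
`Model.typeIdealD`, `Model.locusOf_le_heckeIdealOf`, `squeeze_locusOf_le_heckeIdealOf`) are the LANDED
`Theorems/ParityBlindBianchiTwoAdicBianchiProModularityLevelSqueezeDefsLoci.lean` (p139601) — both imported above
(v5 carried an inline copy of the latter while it was unbuilt; v7 drops it, declarations byte-identical). -/


/-! ### The pure algebra of the squeeze (proved) -/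

/-- A Krull dimension strictly between `⊥` and `⊤` is a natural number. [folklore] -/
theorem exists_nat_of_lt_top {d : WithBot ℕ∞} (hbot : ⊥ < d) (htop : d < ⊤) : ∃ n : ℕ, d = n := by
  induction d using WithBot.recBotCoe with
  | bot => exact absurd hbot (lt_irrefl _)
  | coe e =>
    induction e using ENat.recTopCoe with
    | top => exact absurd htop (by simp)
    | coe n => exact ⟨n, rfl⟩

/-- **Dimension drop.**  In an integral domain `D` of finite Krull dimension, an ideal `J` with
`dim D ≤ dim D/J` is zero: a non-zero `x ∈ J` is a non-zero-divisor, so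
`dim D/J ≤ dim D/(x) ≤ dim D − 1 < dim D` (Krull). [folklore] -/
theorem dimensionDrop {D : Type*} [CommRing D] [IsDomain D] (J : Ideal D)
    (hfin : ringKrullDim D < ⊤) (hle : ringKrullDim D ≤ ringKrullDim (D ⧸ J)) : J = ⊥ := by
  by_contra hJ
  obtain ⟨x, hxJ, hx0⟩ := Submodule.exists_mem_ne_zero_of_ne_bot hJ
  have hxle : Ideal.span {x} ≤ J := (Ideal.span_singleton_le_iff_mem _).mpr hxJ
  have h1 : ringKrullDim (D ⧸ J) ≤ ringKrullDim (D ⧸ Ideal.span {x}) :=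
    ringKrullDim_le_of_surjective (Ideal.Quotient.factor hxle) (Ideal.Quotient.factor_surjective hxle)
  have h2 : ringKrullDim (D ⧸ Ideal.span {x}) + 1 ≤ ringKrullDim D :=
    ringKrullDim_quotient_succ_le_of_nonZeroDivisor (mem_nonZeroDivisors_of_ne_zero hx0)
  have hbot : ⊥ < ringKrullDim D :=
    lt_of_lt_of_le (WithBot.bot_lt_coe (0 : ℕ∞)) ringKrullDim_nonneg_of_nontrivial
  obtain ⟨n, hn⟩ := exists_nat_of_lt_top hbot hfin
  have h3 : ringKrullDim D + 1 ≤ ringKrullDim D := (add_le_add (hle.trans h1) le_rfl).trans h2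
  rw [hn] at h3
  have h4 : ((n + 1 : ℕ) : WithBot ℕ∞) ≤ ((n : ℕ) : WithBot ℕ∞) := by exact_mod_cast h3
  have h5 : n + 1 ≤ n := by exact_mod_cast h4
  omega

/-! ### Stubs -/

/-! `stub_setup` (SETUP) is LANDED: `Theorems/ParityBlindBianchiTwoAdicBianchiProModularityLevelSqueezeStubSetup.lean`
(p138696, stub-worker of lead c14; integral model over `padicCoeffRing E` by a frame change +
Schur for the projectively-`A₅` reduction + `polarizedDeformationRing_nonempty_holds`), imported above
and used by name in `artinLift_of_squeeze`. -/

/-- STUB (GAL, the Galois half; OPEN in general) `stub_galoisDomain` (v3: v2 is false as well —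
`Lines/dimension-squeeze-GALv2-false.md`, unramified-twist sign at an odd bad place with non-abelian inertia image —
so the locus is now that of `typeIdealD` = `typeIdeal` + decomposition traces there, Kisin's component choice; v2 text:) —
**the type-`θ` locus `R^θ := R ⧸ ⨅_{φ type-θ} ker φ` is an integral domain of Krull dimension at
most `4`**, i.e. the Zariski closure in `Spec R` of the characteristic-`0` deformations of `σ̄`
unramified outside `S` with determinant `det σ` and the inertial type of `σ` at the odd bad places
(unrestricted at `v ∣ 2`) is IRREDUCIBLE of dimension `≤ 4` (`= 1 + dim B − l₀` for `PGL₂` at the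
two places over `2`; the Euler-characteristic count gives `≥ 4` on every component).  For `K`
imaginary quadratic with `2` split, `σ` icosahedral of finite image UNRAMIFIED AT THE GOOD PLACES
(so that `x_σ` is a type point and `R^θ ≠ 0`), any integral model and any universal ring `R`.
v1 (the naive quotient `R ⧸ I_θ` with `I_θ` = determinant + `σ`-minimality generators) is FALSE:
it carries the two `𝒪`-points `x_σ`, `x_{σ⊗χ}` of different inertial trace type whenever
`σ(I_w) ∋ −1` at an odd bad `w` (dossier `Lines/dimension-squeeze-GALv1-false.md`); v2 pins the
inertial traces and passes to the reduced `2`-torsion-free closure of the characteristic-`0` points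
(Kisin's typed quotient), which removes that obstruction and the `2`-torsion components of the
naive quotient at once.  ROUTE: Kisin's presentation of `R^{θ,□}` over
`R^{loc} = ⊗̂_{v∣2} R_v^{□,det} ⊗̂ ⊗_{w odd} R_w^{□,τ_w}` with `g − r` explicit; when the strict dual
Selmer group `H¹_{L⊥}(G_{K,S}, pgl₂(σ̄))` VANISHES, `R^{θ,□} ≅ R^{loc}⟦x⟧` and the claim follows
from Böckle–Iyengar–Paškūnas Thm 1.4 (fixed-determinant framed rings at `v ∣ 2` are normal
domains, all `p`) and the typed rings at the odd places; otherwise it is the open question whether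
the `r` Selmer relations cut transversally (Leopoldt-type).
[cite: BoeckleIyengarPaskunas2023, Thm. 1.4] [cite: KisinModuli2009, §2.3 and (3.4.12)]
[cite: Mazur1997Deformation, §26 Prop. 2] [difficulty: open-problem] -/
theorem stub_galoisDomain : ∀ (K : Type) [Field K] [NumberField K], NumberField.IsTotallyComplex K →
    Module.finrank ℚ K = 2 →
    (∃ v w : HeightOneSpectrum (𝓞 K), v ≠ w ∧ ((2 : ℕ) : 𝓞 K) ∈ v.asIdeal ∧
      ((2 : ℕ) : 𝓞 K) ∈ w.asIdeal) →
    ∀ (σ : FramedGaloisRep K (PadicAlgCl 2) 2),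
    Finite σ.toMonoidHom.range → σ.toGaloisRep.IsIrreducible →
    Nonempty ((Matrix.ProjGenLinGroup.mk.comp σ.toMonoidHom).range ≃* alternatingGroup (Fin 5)) →
    ∀ (S₀ : Finset ℕ) (h0 : (0 : ℕ) ∉ S₀) (h2 : 2 ∈ S₀),
    (∀ v : HeightOneSpectrum (𝓞 K), (∀ ℓ ∈ S₀, ((ℓ : ℕ) : 𝓞 K) ∉ v.asIdeal) → σ.IsUnramifiedAt v) →
    ∀ (M : Model σ) (hunr : ∀ v ∉ badSet K S₀, Deformation.IsUnramifiedAt v M.residual)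
      (𝓡 : PolarizedDeformationRing (M.datum S₀ h0 h2 hunr)),
    IsDomain (𝓡.R ⧸ M.locusOf 𝓡 (M.typeIdealD 𝓡)) ∧
      ringKrullDim (𝓡.R ⧸ M.locusOf 𝓡 (M.typeIdealD 𝓡)) ≤ 4 := by
  sorry

/-- STUB (AUT, the automorphic half; OPEN) `stub_heckeDimension` (v3: Hecke points of `V(typeIdealD)`; v2 text:) — **the type-`θ` Hecke points
are Zariski-dense in a `4`-dimensional part of `Spec R`.**  Under the hypotheses of (B) — Hansen data
`a` of `σ` associated at every good place and RESIDUAL OCCURRENCE (an `𝒪_{ℚ̄₂}`-point `b ≡ a` of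
`Spf 𝕋(U₀²)` at some tame level `U₀`) — there is a tame level `U` of type `S₀` (small over the odd
places of `S₀`, detecting `σ`'s inertial types) such that `ringKrullDim (R ⧸ J_U) ≥ 4` (v2: the
Hecke points are type points by definition, so `I^θ ≤ J_U` and the v1 form `R ⧸ (I_θ ⊔ J_U)` is
the same ring up to the reshape of `I_θ`).  ANATOMY (lead c14):
AUT ⇐ DENSITY (pure algebra, provable: the `𝒪_{ℚ̄₂}`-points of a `2`-torsion-free complete
Noetherian local `𝒪`-algebra with finite residue field are Zariski-dense) ∧ SURJ (`R ↠ 𝕋^θ(U²)_𝔪`: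
Scholze's `𝕋`-valued determinant + Chenevier + Carayol, shared with READ) ∧ TYPE (the
`𝒪_{ℚ̄₂}`-points of the fixed-central-character, `σ`-typed `𝕋^θ_𝔪` are type-`θ` Hecke points:
`det ↔` central character by Chebotarev; tame local–global compatibility at the odd places for
torsion classes, ACC+ Thm 26-type) ∧ TF (`𝕋^θ_𝔪` is `2`-torsion-free ⇐ (c)-lite
`H̃₂(U², k)_𝔪 = 0`, GN Rem. 55(3): OPEN) ∧ DIM (`dim 𝕋^θ_𝔪 ≥ 1 + dim B − l₀ = 4` ⇐ GN Prop. 54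
((a),(b) unconditional for `GL₂` over imaginary quadratic `K`) + (c) (Rem. 58: GK-dimension of the
smooth `GL₂(ℚ₂)²`-representation `H̃₁(k)_𝔪/𝔪 ≤ 2`: OPEN) + GN App. §6.3 comparison lemmas +
freeness of the diamond `2`-group action at level `≥ 4` at `2` (all sign/tame types occur,
Carayol-type)).  No patching, no Taylor–Wiles primes, no `p`-adic local–global compatibility at `2`.
CENSUS v7 (lead c14, `Lines/dimension-squeeze-AUT-promote.md`): this stub IS the open core of the automorphic half and
the PROMOTE candidate — with `T := R ⧸ J_U` the Hecke-quotient packaging (`HeckeAlgebraDatum`, landed) is tautological,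
so SURJ/Chenevier/Scholze are not needed; and NO printed framework gives DIM at `p = 2`: Gee–Newton assume
`p > n` (§3.1) and enormous image / `ρ̄ ≇ ρ̄ ⊗ ε̄` for their Taylor–Wiles data (Def. 17, Lemma 22), all of which fail
for `SL₂(𝔽₄)` at `p = 2`; Prop. 54/57 are statements about the patched complex (their HYPOTHESES (a),(b) are the
unconditional part, Rem. 55).  Cheapest falsifier: `2`-power torsion growth in `H₁` of the Bianchi `2`-tower at `𝔪`.
[cite: GeeNewton2020, §3.1, Def. 17, Lemma 22, Prop. 54, Rem. 55, Prop. 57, Rem. 58] [cite: Scholze2015, §V.4, Thm. V.4.1]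
[cite: CalegariEmerton2011, §1 and §8] [difficulty: open-problem] -/
theorem stub_heckeDimension : ∀ (K : Type) [Field K] [NumberField K], NumberField.IsTotallyComplex K →
    Module.finrank ℚ K = 2 →
    (∃ v w : HeightOneSpectrum (𝓞 K), v ≠ w ∧ ((2 : ℕ) : 𝓞 K) ∈ v.asIdeal ∧
      ((2 : ℕ) : 𝓞 K) ∈ w.asIdeal) →
    ∀ (σ : FramedGaloisRep K (PadicAlgCl 2) 2),
    Finite σ.toMonoidHom.range → σ.toGaloisRep.IsIrreducible →
    Nonempty ((Matrix.ProjGenLinGroup.mk.comp σ.toMonoidHom).range ≃* alternatingGroup (Fin 5)) →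
    ∀ (S₀ : Finset ℕ) (h0 : (0 : ℕ) ∉ S₀) (h2 : 2 ∈ S₀)
      (ϖ : ∀ v : HeightOneSpectrum (𝓞 K), (v.adicCompletion K)ˣ),
    (∀ v : HeightOneSpectrum (𝓞 K),
      Valued.v ((ϖ v : (v.adicCompletion K)ˣ) : v.adicCompletion K) = WithZero.exp (-1 : ℤ)) →
    ∀ (a : Good K S₀ → ℕ → O2),
    (∀ (v : HeightOneSpectrum (𝓞 K)) (hv : ∀ ℓ ∈ S₀, ((ℓ : ℕ) : 𝓞 K) ∉ v.asIdeal),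
      σ.IsHeckeAssociatedAt v (fun i : ℕ => if i = 0 then (1 : PadicAlgCl 2) else (a ⟨v, hv⟩ i : PadicAlgCl 2))) →
    (∃ U₀ : Subgroup (GL (Fin 2) (FiniteAdeleRing (𝓞 K) K)), IsTameLevel K S₀ U₀ ∧
      ∃ b : Good K S₀ → ℕ → O2,
        (∀ j : Good K S₀ × Fin 2, ‖(b j.1 (j.2.val + 1) : PadicAlgCl 2) - (a j.1 (j.2.val + 1) : PadicAlgCl 2)‖ < 1) ∧
        IsPointAt K S₀ U₀ ϖ b) →
    ∀ (M : Model σ) (hunr : ∀ v ∉ badSet K S₀, Deformation.IsUnramifiedAt v M.residual)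
      (𝓡 : PolarizedDeformationRing (M.datum S₀ h0 h2 hunr)),
    ∃ U : Subgroup (GL (Fin 2) (FiniteAdeleRing (𝓞 K) K)), IsTameLevel K S₀ U ∧
      (4 : WithBot ℕ∞) ≤ ringKrullDim (𝓡.R ⧸ M.heckeIdealOf 𝓡 (M.typeIdealD 𝓡) U ϖ) := by
  sorry

/-- STUB (READ; theorem-in-print-sized) `stub_zariskiReadout` (v3: loci of `typeIdealD`; `x_σ` kills the
decomposition-trace generators too, `Matrix.trace_units_conj`; v2 text:) — **if the type-`θ` Hecke points
are Zariski-dense in the type locus then the Hansen data of `σ` is a point of `Spf 𝕋(U²)`.**  With `a`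
Hansen-associated with `σ` at every good place and `J_U ≤ I^θ := ⨅_{φ type-θ} ker φ`: every
`𝕋(U²)_𝔪`-relation among the Hecke operators is a relation of `R` (Scholze's `𝕋_𝔪`-valued
determinant, Chenevier's theorem and the density of traces make `q : R ↠ 𝕋(U²)_𝔪`, and every Hecke
point factors through `q` by automatic continuity, so `ker q ≤ J_U`), hence vanishes at the Artin
point `x_σ : R → 𝒪 ⊆ 𝒪_{ℚ̄₂}` (a type point — the model `σ_𝒪` is a type-`𝒟` lift and kills
`I_θ` — so `I^θ ≤ ker x_σ`); the induced `𝕋(U²)_𝔪 → 𝒪_{ℚ̄₂}` is automatically continuous (its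
values on `𝔪` are topologically nilpotent algebraic integers), i.e. `a` is an `IsHeckePoint` — the
converse of `Disproof.IsHeckePoint.lift_mem_span_pow`.
CENSUS v7 (lead c14): LANDED modulo its Hecke half `squeeze_zariskiReadoutOf_of_heckePointsClosed` (p139842 /
…SqueezeReadGeneric), and that half needs NO Galois representation over `𝕋`: `Λ := R ⧸ J_U ↪ ∏_ψ 𝒪_{ℚ̄₂}` is compact
(automatic continuity, Literature `PadicAlgClPointsAutomaticContinuity`), the Hecke points assemble into a continuous
`Θ : 𝕋 → Λ` (`Λ` closed), and `φ̄ ∘ Θ` is the wanted point — modulo ONE piece of tree infrastructure: coefficient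
base change `𝕋_{O2} = O2 ⊗̂ 𝕋_{ℤ₂}` / `Aut(O2)`-equivariance of `IsHeckePoint` for
`Literature.NumberTheory.Automorphic.CompletedCohomology` (the `O2`-linear extension of `φ̄` is well defined iff the
Hecke points are Galois-stable).  Size: M given that infrastructure (`Lines/dimension-squeeze-AUT-promote.md` §3).
[cite: Scholze2015, §V.4, Thm. V.4.1] [cite: Mazur1997Deformation, §20 Prop. 2]
[cite: CalegariEmerton2011, §8] [difficulty: L] -/
theorem stub_zariskiReadout : ∀ (K : Type) [Field K] [NumberField K], NumberField.IsTotallyComplex K →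
    Module.finrank ℚ K = 2 →
    ∀ (σ : FramedGaloisRep K (PadicAlgCl 2) 2),
    Finite σ.toMonoidHom.range → σ.toGaloisRep.IsIrreducible →
    ∀ (S₀ : Finset ℕ) (h0 : (0 : ℕ) ∉ S₀) (h2 : 2 ∈ S₀)
      (ϖ : ∀ v : HeightOneSpectrum (𝓞 K), (v.adicCompletion K)ˣ),
    (∀ v : HeightOneSpectrum (𝓞 K),
      Valued.v ((ϖ v : (v.adicCompletion K)ˣ) : v.adicCompletion K) = WithZero.exp (-1 : ℤ)) →
    ∀ (a : Good K S₀ → ℕ → O2),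
    (∀ (v : HeightOneSpectrum (𝓞 K)) (hv : ∀ ℓ ∈ S₀, ((ℓ : ℕ) : 𝓞 K) ∉ v.asIdeal),
      σ.IsHeckeAssociatedAt v (fun i : ℕ => if i = 0 then (1 : PadicAlgCl 2) else (a ⟨v, hv⟩ i : PadicAlgCl 2))) →
    ∀ (M : Model σ) (hunr : ∀ v ∉ badSet K S₀, Deformation.IsUnramifiedAt v M.residual)
      (𝓡 : PolarizedDeformationRing (M.datum S₀ h0 h2 hunr))
      (U : Subgroup (GL (Fin 2) (FiniteAdeleRing (𝓞 K) K))), IsTameLevel K S₀ U →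
    M.heckeIdealOf 𝓡 (M.typeIdealD 𝓡) U ϖ ≤ M.locusOf 𝓡 (M.typeIdealD 𝓡) → IsPointAt K S₀ U ϖ a := by
  sorry

/-- STUB (A-raw, shared verbatim with line `Sketch`) `stub_classicalHeckePoint` — **a regular
algebraic cuspidal `π₀` of `GL₂(𝔸_K)` IS a point of the big Hecke algebra of the `2`-power Bianchi
tower** (Eichler–Shimura–Harder + Scholze §V.4; the case `p = 2` of the Literature named fact
`bianchi_regularAlgebraicCuspidal_isHeckePoint`, closed in the tree modulo ESH + Borel–Serre FL).
[cite: Scholze2015, §V.4, Thm. V.4.1 and proof of Cor. V.4.2] [cite: Harder1987] [difficulty: L] -/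
theorem stub_classicalHeckePoint : ∀ (K : Type) [Field K] [NumberField K], NumberField.IsTotallyComplex K →
    Module.finrank ℚ K = 2 →
    ∀ (ι : PadicAlgCl 2 ≃+* ℂ) (hcpt : isCompact_glFiniteIntegralLevel 2 K)
      (π₀ : CuspidalAutomorphicRepData 2 K hcpt), π₀.1.IsRegularAlgebraic →
    ∀ S₀ : Finset ℕ, 2 ∈ S₀ →
    (∀ v : HeightOneSpectrum (𝓞 K), (∀ ℓ ∈ S₀, ((ℓ : ℕ) : 𝓞 K) ∉ v.asIdeal) → π₀.1.IsUnramifiedAt v) →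
    ∃ U₀ : Subgroup (GL (Fin 2) (FiniteAdeleRing (𝓞 K) K)),
      IsOpen (U₀ : Set (GL (Fin 2) (FiniteAdeleRing (𝓞 K) K))) ∧
      U₀ ≤ glFiniteIntegralLevel 2 K ∧
      (∀ g ∈ glFiniteIntegralLevel 2 K,
        (∀ v : HeightOneSpectrum (𝓞 K), ¬ (∀ ℓ ∈ S₀, ((ℓ : ℕ) : 𝓞 K) ∉ v.asIdeal) →
          ∀ i j : Fin 2, ((g : Matrix (Fin 2) (Fin 2) (FiniteAdeleRing (𝓞 K) K)) i j) v =
            (1 : Matrix (Fin 2) (Fin 2) (v.adicCompletion K)) i j) → g ∈ U₀) ∧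
      ∀ (ϖ : ∀ v : HeightOneSpectrum (𝓞 K), (v.adicCompletion K)ˣ),
        (∀ v : HeightOneSpectrum (𝓞 K),
          Valued.v ((ϖ v : (v.adicCompletion K)ˣ) : v.adicCompletion K) = WithZero.exp (-1 : ℤ)) →
        ∃ b : {v : HeightOneSpectrum (𝓞 K) // ∀ ℓ ∈ S₀, ((ℓ : ℕ) : 𝓞 K) ∉ v.asIdeal} → ℕ →
            (PadicAlgCl.valued 2).v.valuationSubring,
          (∀ (v : HeightOneSpectrum (𝓞 K)) (hv : ∀ ℓ ∈ S₀, ((ℓ : ℕ) : 𝓞 K) ∉ v.asIdeal)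
              (α : Multiset ℂ), π₀.1.HasSatakeParamAt v α →
            ι ((b ⟨v, hv⟩ 1 : (PadicAlgCl.valued 2).v.valuationSubring) : PadicAlgCl 2) =
                (((Real.sqrt (v.residueCard : ℝ) : ℝ) : ℂ)) * α.esymm 1 ∧
            ι ((b ⟨v, hv⟩ 2 : (PadicAlgCl.valued 2).v.valuationSubring) : PadicAlgCl 2) =
                α.esymm 2) ∧
          IsHeckePoint
            (Matrix.GeneralLinearGroup.map (algebraMap K (FiniteAdeleRing (𝓞 K) K)) :
              GL (Fin 2) K →* GL (Fin 2) (FiniteAdeleRing (𝓞 K) K))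
            (LevelTower.ofSeq U₀ (fun r : ℕ =>
              (principalCongruenceLevel 2 K (Ideal.span {((2 : ℕ) : 𝓞 K)} ^ r)).map (GLn.sndHom 2 K)))
            ((2 : ℕ) : (PadicAlgCl.valued 2).v.valuationSubring)
            (fun j : {v : HeightOneSpectrum (𝓞 K) // ∀ ℓ ∈ S₀, ((ℓ : ℕ) : 𝓞 K) ∉ v.asIdeal} × Fin 2 =>
              GLn.sndHom 2 K (heckeDiagAt 2 K j.1.1 (ϖ j.1.1) (j.2.val + 1)))
            (fun j => b j.1 (j.2.val + 1)) := by
  sorry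

/-! ### The composition -/

/-- **The squeeze, abstractly**: a domain `R ⧸ I` of Krull dimension `≤ 4` and an ideal `J` with
`dim R ⧸ (I ⊔ J) ≥ 4` force `J ≤ I`. [folklore] -/
theorem le_of_squeeze {R : Type*} [CommRing R] (I J : Ideal R) [hdom : IsDomain (R ⧸ I)]
    (hdim : ringKrullDim (R ⧸ I) ≤ 4) (hJ : (4 : WithBot ℕ∞) ≤ ringKrullDim (R ⧸ (I ⊔ J))) :
    J ≤ I := by
  -- `R/(I ⊔ J) ≅ (R/I)/J̄`
  set Jbar : Ideal (R ⧸ I) := J.map (Ideal.Quotient.mk I) with hJbar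
  have e : (R ⧸ I) ⧸ Jbar ≃+* R ⧸ (I ⊔ J) := DoubleQuot.quotQuotEquivQuotSup I J
  have hdimJ : ringKrullDim (R ⧸ I) ≤ ringKrullDim ((R ⧸ I) ⧸ Jbar) := by
    rw [ringKrullDim_eq_of_ringEquiv e]
    exact hdim.trans hJ
  have hfin : ringKrullDim (R ⧸ I) < ⊤ :=
    lt_of_le_of_lt hdim (WithBot.coe_lt_coe.mpr (ENat.coe_lt_top 4))
  have hzero : Jbar = ⊥ := dimensionDrop Jbar hfin hdimJ
  rw [hJbar, Ideal.map_eq_bot_iff_le_ker, Ideal.mk_ker] at hzero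
  exact hzero

/-- **(B) from the squeeze.**  The registered stub `stub_artinLift` of line `Sketch`
(`= ArtinLiftIsHeckePointTwo`, big `R = 𝕋` for `GL₂/K`, `l₀ = 1`, `p = 2`, read at the Artin point)
follows from `stub_setup`, `stub_galoisDomain`, `stub_heckeDimension`, `stub_zariskiReadout` and the
proved `le_of_squeeze`; the branch `0 ∈ S₀` (no good place) is the tree's `isHeckePoint_of_isEmpty`.
[cite: GeeNewton2020, Prop. 54 and Prop. 57] [cite: BoeckleIyengarPaskunas2023, Thm. 1.4] -/
theorem artinLift_of_squeeze : ∀ (K : Type) [Field K] [NumberField K], NumberField.IsTotallyComplex K →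
    Module.finrank ℚ K = 2 →
    (∃ v w : HeightOneSpectrum (𝓞 K), v ≠ w ∧ ((2 : ℕ) : 𝓞 K) ∈ v.asIdeal ∧
      ((2 : ℕ) : 𝓞 K) ∈ w.asIdeal) →
    ∀ (σ : FramedGaloisRep K (PadicAlgCl 2) 2),
    Finite σ.toMonoidHom.range → σ.toGaloisRep.IsIrreducible →
    Nonempty ((Matrix.ProjGenLinGroup.mk.comp σ.toMonoidHom).range ≃* alternatingGroup (Fin 5)) →
    ∀ S₀ : Finset ℕ, 2 ∈ S₀ →
    ∀ (ϖ : ∀ v : HeightOneSpectrum (𝓞 K), (v.adicCompletion K)ˣ),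
    (∀ v : HeightOneSpectrum (𝓞 K),
      Valued.v ((ϖ v : (v.adicCompletion K)ˣ) : v.adicCompletion K) = WithZero.exp (-1 : ℤ)) →
    ∀ (a : {v : HeightOneSpectrum (𝓞 K) // ∀ ℓ ∈ S₀, ((ℓ : ℕ) : 𝓞 K) ∉ v.asIdeal} → ℕ →
      (PadicAlgCl.valued 2).v.valuationSubring),
    (∀ (v : HeightOneSpectrum (𝓞 K)) (hv : ∀ ℓ ∈ S₀, ((ℓ : ℕ) : 𝓞 K) ∉ v.asIdeal),
      σ.IsHeckeAssociatedAt v (fun i : ℕ => if i = 0 then (1 : PadicAlgCl 2) else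
        ((a ⟨v, hv⟩ i : (PadicAlgCl.valued 2).v.valuationSubring) : PadicAlgCl 2))) →
    (∃ U₀ : Subgroup (GL (Fin 2) (FiniteAdeleRing (𝓞 K) K)),
      IsOpen (U₀ : Set (GL (Fin 2) (FiniteAdeleRing (𝓞 K) K))) ∧
      U₀ ≤ glFiniteIntegralLevel 2 K ∧
      (∀ g ∈ glFiniteIntegralLevel 2 K,
        (∀ v : HeightOneSpectrum (𝓞 K), ¬ (∀ ℓ ∈ S₀, ((ℓ : ℕ) : 𝓞 K) ∉ v.asIdeal) →
          ∀ i j : Fin 2, ((g : Matrix (Fin 2) (Fin 2) (FiniteAdeleRing (𝓞 K) K)) i j) v =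
            (1 : Matrix (Fin 2) (Fin 2) (v.adicCompletion K)) i j) → g ∈ U₀) ∧
      ∃ b : {v : HeightOneSpectrum (𝓞 K) // ∀ ℓ ∈ S₀, ((ℓ : ℕ) : 𝓞 K) ∉ v.asIdeal} → ℕ →
          (PadicAlgCl.valued 2).v.valuationSubring,
        (∀ j : {v : HeightOneSpectrum (𝓞 K) // ∀ ℓ ∈ S₀, ((ℓ : ℕ) : 𝓞 K) ∉ v.asIdeal} × Fin 2,
          ‖((b j.1 (j.2.val + 1) : (PadicAlgCl.valued 2).v.valuationSubring) : PadicAlgCl 2) -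
            ((a j.1 (j.2.val + 1) : (PadicAlgCl.valued 2).v.valuationSubring) : PadicAlgCl 2)‖ < 1) ∧
        IsHeckePoint
          (Matrix.GeneralLinearGroup.map (algebraMap K (FiniteAdeleRing (𝓞 K) K)) :
            GL (Fin 2) K →* GL (Fin 2) (FiniteAdeleRing (𝓞 K) K))
          (LevelTower.ofSeq U₀ (fun r : ℕ =>
            (principalCongruenceLevel 2 K (Ideal.span {((2 : ℕ) : 𝓞 K)} ^ r)).map (GLn.sndHom 2 K)))
          ((2 : ℕ) : (PadicAlgCl.valued 2).v.valuationSubring)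
          (fun j : {v : HeightOneSpectrum (𝓞 K) // ∀ ℓ ∈ S₀, ((ℓ : ℕ) : 𝓞 K) ∉ v.asIdeal} × Fin 2 =>
            GLn.sndHom 2 K (heckeDiagAt 2 K j.1.1 (ϖ j.1.1) (j.2.val + 1)))
          (fun j => b j.1 (j.2.val + 1))) →
    ∃ U : Subgroup (GL (Fin 2) (FiniteAdeleRing (𝓞 K) K)),
      IsOpen (U : Set (GL (Fin 2) (FiniteAdeleRing (𝓞 K) K))) ∧
      U ≤ glFiniteIntegralLevel 2 K ∧
      (∀ g ∈ glFiniteIntegralLevel 2 K,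
        (∀ v : HeightOneSpectrum (𝓞 K), ¬ (∀ ℓ ∈ S₀, ((ℓ : ℕ) : 𝓞 K) ∉ v.asIdeal) →
          ∀ i j : Fin 2, ((g : Matrix (Fin 2) (Fin 2) (FiniteAdeleRing (𝓞 K) K)) i j) v =
            (1 : Matrix (Fin 2) (Fin 2) (v.adicCompletion K)) i j) → g ∈ U) ∧
      IsHeckePoint
        (Matrix.GeneralLinearGroup.map (algebraMap K (FiniteAdeleRing (𝓞 K) K)) :
          GL (Fin 2) K →* GL (Fin 2) (FiniteAdeleRing (𝓞 K) K))
        (LevelTower.ofSeq U (fun r : ℕ =>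
          (principalCongruenceLevel 2 K (Ideal.span {((2 : ℕ) : 𝓞 K)} ^ r)).map (GLn.sndHom 2 K)))
        ((2 : ℕ) : (PadicAlgCl.valued 2).v.valuationSubring)
        (fun j : {v : HeightOneSpectrum (𝓞 K) // ∀ ℓ ∈ S₀, ((ℓ : ℕ) : 𝓞 K) ∉ v.asIdeal} × Fin 2 =>
          GLn.sndHom 2 K (heckeDiagAt 2 K j.1.1 (ϖ j.1.1) (j.2.val + 1)))
        (fun j => a j.1 (j.2.val + 1)) := by
  intro K _ _ htc hdeg hsplit σ hfin hirr hA5 S₀ h2 ϖ hϖ a hassoc hocc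
  by_cases h0 : (0 : ℕ) ∈ S₀
  · -- no good place: the empty Hecke family is a point of `𝕋(GL₂(𝒪̂)²)`
    haveI : IsEmpty {v : HeightOneSpectrum (𝓞 K) // ∀ ℓ ∈ S₀, ((ℓ : ℕ) : 𝓞 K) ∉ v.asIdeal} :=
      ⟨fun v => Theorems.TwoAdicBianchiProModularityLevel.not_good_of_zero_mem h0 v.1 v.2⟩
    refine ⟨glFiniteIntegralLevel 2 K, isOpen_glFiniteIntegralLevel 2 K, le_rfl, fun g hg _ => hg, ?_⟩
    exact isHeckePoint_of_isEmpty (not_isUnit_natCast_valuationSubring_padicAlgCl 2)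
  · -- the squeeze
    obtain ⟨M, hM⟩ := stub_setup K σ hfin hirr hA5
    have hunr : ∀ v ∉ badSet K S₀, Deformation.IsUnramifiedAt v M.residual := by
      intro v hv
      have hgood : ∀ ℓ ∈ S₀, ((ℓ : ℕ) : 𝓞 K) ∉ v.asIdeal := by
        by_contra h
        exact hv h
      exact M.isUnramifiedAt_residual (hassoc v hgood).isUnramifiedAt
    obtain ⟨𝓡⟩ := hM S₀ h0 h2 hunr
    obtain ⟨hdom, hdim⟩ := stub_galoisDomain K htc hdeg hsplit σ hfin hirr hA5 S₀ h0 h2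
      (fun v hv => (hassoc v hv).isUnramifiedAt) M hunr 𝓡
    have hocc' : ∃ U₀ : Subgroup (GL (Fin 2) (FiniteAdeleRing (𝓞 K) K)), IsTameLevel K S₀ U₀ ∧
        ∃ b : Good K S₀ → ℕ → O2,
          (∀ j : Good K S₀ × Fin 2,
            ‖(b j.1 (j.2.val + 1) : PadicAlgCl 2) - (a j.1 (j.2.val + 1) : PadicAlgCl 2)‖ < 1) ∧
          IsPointAt K S₀ U₀ ϖ b := by
      obtain ⟨U₀, hU₀o, hU₀le, hU₀3, b, hb, hbpt⟩ := hocc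
      exact ⟨U₀, ⟨hU₀o, hU₀le, hU₀3⟩, b, hb, hbpt⟩
    obtain ⟨U, hU, hJ⟩ :=
      stub_heckeDimension K htc hdeg hsplit σ hfin hirr hA5 S₀ h0 h2 ϖ hϖ a hassoc hocc' M hunr 𝓡
    haveI := hdom
    -- the Hecke points are type points, so `I^θ ⊔ J_U = J_U`
    have hsup : M.locusOf 𝓡 (M.typeIdealD 𝓡) ⊔ M.heckeIdealOf 𝓡 (M.typeIdealD 𝓡) U ϖ =
        M.heckeIdealOf 𝓡 (M.typeIdealD 𝓡) U ϖ :=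
      sup_eq_right.mpr (M.locusOf_le_heckeIdealOf 𝓡 _ U ϖ)
    have hJ' : (4 : WithBot ℕ∞) ≤
        ringKrullDim (𝓡.R ⧸ (M.locusOf 𝓡 (M.typeIdealD 𝓡) ⊔ M.heckeIdealOf 𝓡 (M.typeIdealD 𝓡) U ϖ)) := by
      rw [hsup]
      exact hJ
    have hle : M.heckeIdealOf 𝓡 (M.typeIdealD 𝓡) U ϖ ≤ M.locusOf 𝓡 (M.typeIdealD 𝓡) :=
      le_of_squeeze _ _ hdim hJ'
    have hpt : IsPointAt K S₀ U ϖ a :=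
      stub_zariskiReadout K htc hdeg σ hfin hirr S₀ h0 h2 ϖ hϖ a hassoc M hunr 𝓡 U hU hle
    exact ⟨U, hU.1, hU.2.1, hU.2.2, hpt⟩

/-- COMPOSITION: the stubs imply the crux `TwoAdicBianchiProModularityLevel` BY NAME — the landed
bridge `crux ⇐ A ∧ B` (p108612) fed with `stub_classicalHeckePoint` (A-raw) and
`artinLift_of_squeeze` (B from GAL ∧ AUT ∧ READ ∧ setup).
[cite: GeeNewton2020, Prop. 54 and Prop. 57] [cite: Scholze2015, §V.4] -/
theorem TwoAdicBianchiProModularityLevel_of :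
    Summit.Langlands.Langlands.Theses.ParityBlindBianchi.TwoAdicBianchiProModularityLevel :=
  Theorems.TwoAdicBianchiProModularityLevel.TwoAdicBianchiProModularityLevel_of_classicalPoint_artinLift
    stub_classicalHeckePoint artinLift_of_squeeze

end Summit.Langlands.Langlands.Cruxes.TwoAdicBianchiProModularityLevel.DimensionSqueeze

end
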